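/-
Copyright (c) 2026 the pub-hodgecm-mathlib formalisation cell (harness21).  Prover seat hodgecm-mathlib-K2E5-p16 (g6), Track B «K2-LIT»,
#184♮ = hLiu418 = `stmt-HodgeConjecture-24832`; A7-val ROAD (σ) «NULL-CONE MULTIPLICITY ONE», file V4b `K2LiuHomogeneousFunctionalVanishing`
(K2Liu-p09 (g6) interface word 11:27:21Z (c): «the WRONG-CHARACTER VANISHING criterion V5 needs on every stratum but the surviving one»).
THEOREMS ONLY (no `def`, no `instance`, no notation, no named-fact hypothesis, no `sorry`; no Haar measure, no modular function).
-/
import Summits.HodgeConjecture.HodgeConjecture.Theorems.K2LiuHomogeneousFunctionalLine   -- ★ (this seat) V4: the line, transport, cells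
import Mathlib.MeasureTheory.Function.LocallyIntegrable
import HarnessLib

/-!
# Crux `HLiu418`, A7-val road (σ), V4b: a semi-invariant functional with the WRONG character at a stabiliser element vanishes

Cell `hodgecm-mathlib`, crux item hLiu418 = `stmt-HodgeConjecture-24832` (helper lane `--supports`, count-neutral).

Setting of ★ V4 (`K2LiuHomogeneousFunctionalLine`): `G` totally disconnected with a compact open subgroup `K₀`, acting continuously and transitively on `X`
with open orbit maps; `χ : G →* ℂ` trivial on `K₀`; `T` a `χ`-semi-invariant functional on `S(X)` (`T (F ∘ (g • ·)) = χ g · T F`).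
**THE CRITERION** (`apply_base_eq_zero_of_char_ne`, `eq_zero_of_char_ne`).  Let `γ ∈ G` FIX the base point, `γ • x₀ = x₀`.  If there is ANY non-degenerate
reference functional `T′` (`T′(1_{K₀•x₀}) ≠ 0`), semi-invariant for a character `χ′` trivial on `K₀` with `χ′ γ ≠ χ γ`, then `T(1_{K₀•x₀}) = 0`, hence
`T = 0` on `S(X)` (★ V4 `eq_zero_of_apply_base_eq_zero`).  MEASURE INSTANCE (`apply_base_eq_zero_of_char_ne_integral`): `T′ = ∫ · dμ` for a measure `μ`
finite on compact sets with `∫ F(g • y) dμ = χ′ g · ∫ F dμ` on `S(X)` and `μ(K₀ • x₀) ≠ 0` (a relatively invariant measure on the stratum).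
THE PROOF.  `γ • (K₀ • x₀) = (γK₀γ⁻¹) • x₀` (§2), so by ★ V4's transport `T(1_{(γK₀γ⁻¹)•x₀}) = χ(γ⁻¹)·T(1_{K₀•x₀})`; by the RATIO lemma the same cell ratio is a
positive rational `q` INDEPENDENT OF THE FUNCTIONAL AND OF THE CHARACTER (§1 — ★ V4's count∕ratio re-stated with the character quantified inside); reading
`q` off `T′` gives `q = χ′(γ⁻¹)`, so `T(1_{K₀•x₀}) ≠ 0` would force `χ(γ⁻¹) = χ′(γ⁻¹)`, i.e. `χ γ = χ′ γ`.
Consumer: V5 `K2LiuNullConeMultiplicityOne` (the strata `O_{ij} ≠ O_{11}`, `{0}`, and the open split strata carry the law of a wrong `s`).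
References: [BernsteinZelevinsky1976, §1.18–1.21]; [Rallis1984]; [KudlaRallis1990, §2–3]; [KudlaSweet1997, §§2–4].
HONEST LABEL: HC_CM is proved only modulo the 7 printed citations (2 remaining named inputs: hLiu418 = stmt-HodgeConjecture-24832,
h413 = stmt-HodgeConjecture-24833) until rung 0 closes; count-neutral helper, closes no socket.
-/

set_option autoImplicit false
set_option linter.dupNamespace false

noncomputable section

open Set Filter Topology MulAction MeasureTheory Literature.Topology Literature.MeasureTheory.Group
open scoped Pointwise

namespace Summit.HodgeConjecture.HodgeConjecture.Cruxes.HLiu418.K2LiuHomogeneousFunctionalVanishing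

open Summit.HodgeConjecture.HodgeConjecture.Cruxes.HLiu418.K2LiuHomogeneousFunctionalLine

/-! ## §1  The count and the ratio are GEOMETRIC: uniform in the character and in the functional -/

section Count

variable {G : Type*} [Group G] [TopologicalSpace G] [IsTopologicalGroup G] {X : Type*} [TopologicalSpace X] [MulAction G X]

/-- **REFINEMENT COUNT, uniform in `(χ, T)`**: `∃ k ≥ 1, ∀ χ` trivial on `M`, `∀ T` `χ`-semi-invariant, `T(1_{M•x}) = k · T(1_{N•x})`
(`N ≤ M` open, normalised by the compact open `M`). [BernsteinZelevinsky1976, §1.18] -/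
theorem exists_pos_forall_char_apply_indicator_orbit_eq_natCast_mul (hcont : ∀ x : X, Continuous fun g : G => g • x)
    (hopen : ∀ x : X, IsOpenMap fun g : G => g • x) {M N : Subgroup G} (hMc : IsCompact (M : Set G))
    (hNo : IsOpen (N : Set G)) (hNM : N ≤ M) (hnorm : ∀ m ∈ M, ∀ n ∈ N, m * n * m⁻¹ ∈ N) (x : X) :
    ∃ k : ℕ, 0 < k ∧ ∀ (χ : G →* ℂ), (∀ m ∈ M, χ m = 1) → ∀ (T : (X → ℂ) →ₗ[ℂ] ℂ),
      (∀ F : X → ℂ, IsLocallyConstant F → HasCompactSupport F → ∀ g : G, T (fun y => F (g • y)) = χ g * T F) →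
        T ((orbit M x).indicator fun _ => (1 : ℂ)) = (k : ℂ) * T ((orbit N x).indicator fun _ => (1 : ℂ)) := by
  classical
  obtain ⟨A, hxA, htrans, hdisj, hU⟩ :=
    exists_finset_orbit_eq_biUnion_smul_orbit hcont hMc (isOpen_orbit_subgroup hopen N hNo) hNM hnorm x
  have hNc : IsCompact (N : Set G) := hMc.of_isClosed_subset (N.isClosed_of_isOpen hNo) (SetLike.coe_subset_coe.2 hNM)
  have hcell_o : IsOpen (orbit N x) := isOpen_orbit_subgroup hopen N hNo x
  have hcell_c : IsCompact (orbit N x) := isCompact_orbit_subgroup hcont N hNc x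
  have hcell_cl : IsClosed (orbit N x) := isClosed_orbit_subgroup hopen N hNo x
  refine ⟨A.card, Finset.card_pos.2 ⟨_, hxA⟩, fun χ hχ T hT => ?_⟩
  have hind : (orbit M x).indicator (fun _ => (1 : ℂ)) = ∑ ω ∈ A, (orbitRel.Quotient.orbit ω).indicator fun _ => (1 : ℂ) := by
    rw [hU, Finset.indicator_biUnion A _ hdisj, ← Finset.sum_fn]
  rw [hind, _root_.map_sum]
  have hterm : ∀ ω ∈ A, T ((orbitRel.Quotient.orbit ω).indicator fun _ => (1 : ℂ)) = T ((orbit N x).indicator fun _ => (1 : ℂ)) := by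
    intro ω hω
    obtain ⟨m, hm, hmω⟩ := htrans ω hω
    rw [hmω, apply_indicator_smul_set_eq_mul hcell_o hcell_c hcell_cl χ T hT m 1, char_inv_eq_one χ hχ hm, one_mul]
  rw [Finset.sum_congr rfl hterm, Finset.sum_const, nsmul_eq_mul]

/-- **THE CELL RATIO IS GEOMETRIC**: for compact open subgroups `M₁, M₂` of a totally disconnected group, `∃ q > 0` such that for EVERY character `χ`
trivial on `M₁` and `M₂` and EVERY `χ`-semi-invariant `T`: `T(1_{M₁•x}) = q · T(1_{M₂•x})`. [BernsteinZelevinsky1976, §1.18] -/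
theorem exists_pos_forall_char_apply_indicator_orbit_eq_mul [TotallyDisconnectedSpace G] (hcont : ∀ x : X, Continuous fun g : G => g • x)
    (hopen : ∀ x : X, IsOpenMap fun g : G => g • x) {M₁ M₂ : Subgroup G} (h₁o : IsOpen (M₁ : Set G)) (h₁c : IsCompact (M₁ : Set G))
    (h₂o : IsOpen (M₂ : Set G)) (h₂c : IsCompact (M₂ : Set G)) (x : X) :
    ∃ q : ℝ, 0 < q ∧ ∀ (χ : G →* ℂ), (∀ m ∈ M₁, χ m = 1) → (∀ m ∈ M₂, χ m = 1) → ∀ (T : (X → ℂ) →ₗ[ℂ] ℂ),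
      (∀ F : X → ℂ, IsLocallyConstant F → HasCompactSupport F → ∀ g : G, T (fun y => F (g • y)) = χ g * T F) →
        T ((orbit M₁ x).indicator fun _ => (1 : ℂ)) = (q : ℂ) * T ((orbit M₂ x).indicator fun _ => (1 : ℂ)) := by
  obtain ⟨N₁, hN₁o, hN₁M₁, hN₁M₂, hN₁n⟩ :=
    Literature.Topology.Algebra.exists_isOpen_subgroup_le_subset_conj_mem M₁ h₁o h₁c (h₂o.mem_nhds M₂.one_mem)
  obtain ⟨N₂, hN₂o, hN₂M₂, hN₂N₁, hN₂n⟩ :=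
    Literature.Topology.Algebra.exists_isOpen_subgroup_le_subset_conj_mem M₂ h₂o h₂c (hN₁o.mem_nhds N₁.one_mem)
  have hN₁c : IsCompact (N₁ : Set G) := h₁c.of_isClosed_subset (N₁.isClosed_of_isOpen hN₁o) (SetLike.coe_subset_coe.2 hN₁M₁)
  have hN₂N₁' : N₂ ≤ N₁ := SetLike.coe_subset_coe.1 hN₂N₁
  have hN₂n' : ∀ m ∈ N₁, ∀ n ∈ N₂, m * n * m⁻¹ ∈ N₂ := fun m hm n hn => hN₂n m (hN₁M₂ hm) n hn
  obtain ⟨a, ha, hTa⟩ := exists_pos_forall_char_apply_indicator_orbit_eq_natCast_mul hcont hopen h₁c hN₁o hN₁M₁ hN₁n x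
  obtain ⟨b, hb, hTb⟩ := exists_pos_forall_char_apply_indicator_orbit_eq_natCast_mul hcont hopen hN₁c hN₂o hN₂N₁' hN₂n' x
  obtain ⟨c, hc, hTc⟩ := exists_pos_forall_char_apply_indicator_orbit_eq_natCast_mul hcont hopen h₂c hN₂o hN₂M₂ hN₂n x
  refine ⟨(a : ℝ) * b / c, by positivity, fun χ hχ₁ hχ₂ T hT => ?_⟩
  have hχN₁ : ∀ m ∈ N₁, χ m = 1 := fun m hm => hχ₁ m (hN₁M₁ hm)
  have hc0 : (c : ℂ) ≠ 0 := by exact_mod_cast hc.ne'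
  rw [hTa χ hχ₁ T hT, hTb χ hχN₁ T hT]
  have h3 := hTc χ hχ₂ T hT
  have hN₂ : T ((orbit N₂ x).indicator fun _ => (1 : ℂ)) = (c : ℂ)⁻¹ * T ((orbit M₂ x).indicator fun _ => (1 : ℂ)) := by
    rw [h3, ← mul_assoc, inv_mul_cancel₀ hc0, one_mul]
  rw [hN₂]
  push_cast
  field_simp

end Count

/-! ## §2  A stabiliser element moves the base cell to the cell of a conjugate subgroup -/

section Stabiliser

variable {G : Type*} [Group G] {X : Type*} [MulAction G X]

/-- `(γK₀γ⁻¹)^γ = K₀`: `(K₀.comap (conj γ⁻¹)).comap (conj γ) = K₀`. [folklore] -/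
theorem comap_conj_inv_comap_conj (K₀ : Subgroup G) (γ : G) :
    (K₀.comap (MulAut.conj γ⁻¹).toMonoidHom).comap (MulAut.conj γ).toMonoidHom = K₀ := by
  ext k
  rw [mem_comap_conj_iff, mem_comap_conj_iff]
  have : γ⁻¹ * (γ * k * γ⁻¹) * γ⁻¹⁻¹ = k := by group
  rw [this]

/-- **`(γK₀γ⁻¹) • x₀ = γ • (K₀ • x₀)` when `γ • x₀ = x₀`.** [BernsteinZelevinsky1976, §1.5] -/
theorem orbit_comap_conj_inv_eq_smul_orbit (K₀ : Subgroup G) {γ : G} {x₀ : X} (hγ : γ • x₀ = x₀) :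
    orbit (K₀.comap (MulAut.conj γ⁻¹).toMonoidHom) x₀ = γ • orbit K₀ x₀ := by
  have h := orbit_smul_eq_smul_orbit_comap_conj (K₀.comap (MulAut.conj γ⁻¹).toMonoidHom) γ x₀
  rw [hγ, comap_conj_inv_comap_conj] at h
  exact h

/-- A character trivial on `K₀` is trivial on `γK₀γ⁻¹`. [folklore] -/
theorem char_eq_one_of_mem_comap_conj_inv {K₀ : Subgroup G} (χ : G →* ℂ) (hχ : ∀ k ∈ K₀, χ k = 1) (γ : G) :
    ∀ k ∈ K₀.comap (MulAut.conj γ⁻¹).toMonoidHom, χ k = 1 :=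
  char_eq_one_of_mem_comap_conj χ hχ γ⁻¹

/-- A multiplicative character into `ℂ` is injective on inverses: `χ γ⁻¹ = χ′ γ⁻¹ → χ γ = χ′ γ`. [folklore] -/
theorem char_eq_of_inv_eq (χ χ' : G →* ℂ) {γ : G} (h : χ γ⁻¹ = χ' γ⁻¹) : χ γ = χ' γ := by
  have h1 : χ γ * χ γ⁻¹ = 1 := by rw [← map_mul, mul_inv_cancel, map_one]
  have h2 : χ' γ * χ' γ⁻¹ = 1 := by rw [← map_mul, mul_inv_cancel, map_one]
  have hne : χ γ⁻¹ ≠ 0 := fun h0 => by rw [h0, mul_zero] at h1; exact zero_ne_one h1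
  have : χ γ * χ γ⁻¹ = χ' γ * χ γ⁻¹ := by rw [h1, h, h2]
  exact mul_right_cancel₀ hne this

end Stabiliser

/-! ## §3  The wrong-character vanishing criterion -/

section Main

variable {G : Type*} [Group G] [TopologicalSpace G] [IsTopologicalGroup G] [TotallyDisconnectedSpace G]
  {X : Type*} [TopologicalSpace X] [MulAction G X] [ContinuousSMul G X]

/-- **THE CELL RATIO AT A STABILISER ELEMENT IS THE CHARACTER VALUE**: if `γ • x₀ = x₀`, there is ONE positive real `q` with
`χ(γ⁻¹) · T(1_{K₀•x₀}) = q · T(1_{K₀•x₀})` for every character `χ` trivial on `K₀` and every `χ`-semi-invariant `T`. [KudlaRallis1990, §2] -/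
theorem exists_pos_forall_char_mul_apply_base_eq (K₀ : Subgroup G) (hK₀o : IsOpen (K₀ : Set G)) (hK₀c : IsCompact (K₀ : Set G))
    (hopen : ∀ x : X, IsOpenMap fun g : G => g • x) {γ : G} {x₀ : X} (hγ : γ • x₀ = x₀) :
    ∃ q : ℝ, 0 < q ∧ ∀ (χ : G →* ℂ), (∀ k ∈ K₀, χ k = 1) → ∀ (T : (X → ℂ) →ₗ[ℂ] ℂ),
      (∀ F : X → ℂ, IsLocallyConstant F → HasCompactSupport F → ∀ g : G, T (fun y => F (g • y)) = χ g * T F) →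
        χ γ⁻¹ * T ((orbit K₀ x₀).indicator fun _ => (1 : ℂ)) = (q : ℂ) * T ((orbit K₀ x₀).indicator fun _ => (1 : ℂ)) := by
  have hcont : ∀ x : X, Continuous fun g : G => g • x := fun x => continuous_id.smul continuous_const
  set K' : Subgroup G := K₀.comap (MulAut.conj γ⁻¹).toMonoidHom with hK'
  have hK'o : IsOpen (K' : Set G) := isOpen_coe_comap_conj K₀ hK₀o γ⁻¹
  have hK'c : IsCompact (K' : Set G) := isCompact_coe_comap_conj K₀ hK₀c γ⁻¹
  obtain ⟨q, hq, hratio⟩ := exists_pos_forall_char_apply_indicator_orbit_eq_mul hcont hopen hK'o hK'c hK₀o hK₀c x₀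
  refine ⟨q, hq, fun χ hχ T hT => ?_⟩
  have hχK' : ∀ k ∈ K', χ k = 1 := char_eq_one_of_mem_comap_conj_inv χ hχ γ
  -- `T(1_{K'•x₀}) = T(1_{γ•(K₀•x₀)}) = χ(γ⁻¹)·T(1_{K₀•x₀})` and `= q·T(1_{K₀•x₀})`
  have h1 := hratio χ hχK' hχ T hT
  rw [hK', orbit_comap_conj_inv_eq_smul_orbit K₀ hγ,
    apply_indicator_smul_set_eq_mul (isOpen_orbit_subgroup hopen K₀ hK₀o x₀) (isCompact_orbit_subgroup hcont K₀ hK₀c x₀)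
      (isClosed_orbit_subgroup hopen K₀ hK₀o x₀) χ T hT γ 1] at h1
  exact h1

/-- **WRONG-CHARACTER VANISHING AT THE BASE CELL.**  `γ • x₀ = x₀`; `T` is `χ`-semi-invariant, `T′` is `χ′`-semi-invariant (both characters trivial
on `K₀`), `T′(1_{K₀•x₀}) ≠ 0` and `χ γ ≠ χ′ γ`.  Then `T(1_{K₀•x₀}) = 0`. [Rallis1984; KudlaRallis1990, §2–3; KudlaSweet1997, §2] -/
theorem apply_base_eq_zero_of_char_ne (K₀ : Subgroup G) (hK₀o : IsOpen (K₀ : Set G)) (hK₀c : IsCompact (K₀ : Set G))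
    (hopen : ∀ x : X, IsOpenMap fun g : G => g • x) {γ : G} {x₀ : X} (hγ : γ • x₀ = x₀) (χ χ' : G →* ℂ)
    (hχ : ∀ k ∈ K₀, χ k = 1) (hχ' : ∀ k ∈ K₀, χ' k = 1) (T T' : (X → ℂ) →ₗ[ℂ] ℂ)
    (hT : ∀ F : X → ℂ, IsLocallyConstant F → HasCompactSupport F → ∀ g : G, T (fun y => F (g • y)) = χ g * T F)
    (hT' : ∀ F : X → ℂ, IsLocallyConstant F → HasCompactSupport F → ∀ g : G, T' (fun y => F (g • y)) = χ' g * T' F)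
    (hne' : T' ((orbit K₀ x₀).indicator fun _ => (1 : ℂ)) ≠ 0) (hχγ : χ γ ≠ χ' γ) :
    T ((orbit K₀ x₀).indicator fun _ => (1 : ℂ)) = 0 := by
  obtain ⟨q, -, h⟩ := exists_pos_forall_char_mul_apply_base_eq K₀ hK₀o hK₀c hopen hγ
  have h1 := h χ hχ T hT
  have h2 := h χ' hχ' T' hT'
  -- from `T′`: `q = χ′(γ⁻¹)`
  have hq : (q : ℂ) = χ' γ⁻¹ := (mul_right_cancel₀ hne' h2).symm
  rw [hq] at h1
  by_contra hT0
  exact hχγ (char_eq_of_inv_eq χ χ' (mul_right_cancel₀ hT0 h1))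

/-- **WRONG-CHARACTER VANISHING ON `S(X)`**: under the hypotheses of `apply_base_eq_zero_of_char_ne`, `T F = 0` for every locally constant compactly
supported `F`. [Rallis1984; KudlaRallis1990, §2–3; KudlaSweet1997, §2] -/
theorem eq_zero_of_char_ne (K₀ : Subgroup G) (hK₀o : IsOpen (K₀ : Set G)) (hK₀c : IsCompact (K₀ : Set G))
    (hopen : ∀ x : X, IsOpenMap fun g : G => g • x) [IsPretransitive G X] {γ : G} {x₀ : X} (hγ : γ • x₀ = x₀) (χ χ' : G →* ℂ)
    (hχ : ∀ k ∈ K₀, χ k = 1) (hχ' : ∀ k ∈ K₀, χ' k = 1) (T T' : (X → ℂ) →ₗ[ℂ] ℂ)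
    (hT : ∀ F : X → ℂ, IsLocallyConstant F → HasCompactSupport F → ∀ g : G, T (fun y => F (g • y)) = χ g * T F)
    (hT' : ∀ F : X → ℂ, IsLocallyConstant F → HasCompactSupport F → ∀ g : G, T' (fun y => F (g • y)) = χ' g * T' F)
    (hne' : T' ((orbit K₀ x₀).indicator fun _ => (1 : ℂ)) ≠ 0) (hχγ : χ γ ≠ χ' γ)
    {F : X → ℂ} (hF : IsLocallyConstant F) (hFs : HasCompactSupport F) : T F = 0 :=
  eq_zero_of_apply_base_eq_zero K₀ hK₀o hK₀c hopen χ hχ x₀ T hT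
    (apply_base_eq_zero_of_char_ne K₀ hK₀o hK₀c hopen hγ χ χ' hχ hχ' T T' hT hT' hne' hχγ) hF hFs

/-! ## §4  The measure instance: a relatively invariant measure on the stratum as the reference functional -/

/-- The indicator of an open compact closed cell integrates to its (real) mass. [folklore] -/
theorem integral_indicator_orbit_eq [MeasurableSpace X] [OpensMeasurableSpace X] (μ : Measure X) {S : Set X} (hSo : IsOpen S) :
    ∫ y, S.indicator (fun _ => (1 : ℂ)) y ∂μ = (μ.real S : ℂ) := by
  rw [integral_indicator_const (1 : ℂ) hSo.measurableSet, Complex.real_smul, mul_one]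

omit [IsTopologicalGroup G] [TotallyDisconnectedSpace G] in
/-- **A RELATIVELY INVARIANT MEASURE YIELDS A REFERENCE FUNCTIONAL**: if `μ` is finite on compact sets and `∫ F(g • y) dμ = χ′ g · ∫ F dμ` on `S(X)`, there is a
`ℂ`-linear `T′` on `X → ℂ`, `χ′`-semi-invariant on `S(X)`, with `T′ F = ∫ F dμ` for `F ∈ S(X)` (★ COINV-1's `LinearMap.exists_extend` pattern).
[BernsteinZelevinsky1976, §1.18] -/
theorem exists_linear_extension_integral [MeasurableSpace X] [OpensMeasurableSpace X] (μ : Measure X) [IsFiniteMeasureOnCompacts μ]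
    (χ' : G →* ℂ)
    (hμ : ∀ (g : G) (F : X → ℂ), IsLocallyConstant F → HasCompactSupport F → ∫ y, F (g • y) ∂μ = χ' g * ∫ y, F y ∂μ) :
    ∃ T' : (X → ℂ) →ₗ[ℂ] ℂ, (∀ F : X → ℂ, IsLocallyConstant F → HasCompactSupport F → T' F = ∫ y, F y ∂μ) ∧
      ∀ F : X → ℂ, IsLocallyConstant F → HasCompactSupport F → ∀ g : G, T' (fun y => F (g • y)) = χ' g * T' F := by
  -- the submodule `S(X)` of test functions
  let V : Submodule ℂ (X → ℂ) :=
    { carrier := {F | IsLocallyConstant F ∧ HasCompactSupport F}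
      add_mem' := fun {F F'} hF hF' => ⟨hF.1.add hF'.1, hF.2.add hF'.2⟩
      zero_mem' := ⟨IsLocallyConstant.const (0 : ℂ), HasCompactSupport.zero⟩
      smul_mem' := fun a F hF => ⟨hF.1.comp fun z => a • z, hF.2.smul_left⟩ }
  have hVmem : ∀ {F : X → ℂ}, F ∈ V ↔ IsLocallyConstant F ∧ HasCompactSupport F := fun {F} => Iff.rfl
  have hint : ∀ {F : X → ℂ}, IsLocallyConstant F → HasCompactSupport F → Integrable F μ :=
    fun {F} hF hFs => hF.continuous.integrable_of_hasCompactSupport hFs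
  -- `∫ · dμ` is linear on `S(X)`
  let T₀ : V →ₗ[ℂ] ℂ :=
    { toFun := fun F => ∫ y, (F : X → ℂ) y ∂μ
      map_add' := fun F F' => by
        simpa only [Submodule.coe_add, Pi.add_apply] using integral_add (hint F.2.1 F.2.2) (hint F'.2.1 F'.2.2)
      map_smul' := fun a F => by
        simpa only [Submodule.coe_smul, Pi.smul_apply, smul_eq_mul, RingHom.id_apply] using integral_const_mul a (F : X → ℂ) }
  obtain ⟨T₁, hT₁⟩ := LinearMap.exists_extend T₀
  have hT₁V : ∀ F : X → ℂ, IsLocallyConstant F → HasCompactSupport F → T₁ F = ∫ y, F y ∂μ := fun F hF hFs => by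
    have := LinearMap.congr_fun hT₁ ⟨F, hVmem.2 ⟨hF, hFs⟩⟩
    simpa [T₀] using this
  refine ⟨T₁, hT₁V, fun F hF hFs g => ?_⟩
  have hF' : IsLocallyConstant fun y => F (g • y) := hF.comp_continuous (continuous_const_smul g)
  have hFs' : HasCompactSupport fun y => F (g • y) := hFs.comp_homeomorph (Homeomorph.smul g)
  rw [hT₁V _ hF' hFs', hT₁V F hF hFs, hμ g F hF hFs]

/-- **WRONG-CHARACTER VANISHING, MEASURE FORM.**  `γ • x₀ = x₀`; `μ` a measure on `X` finite on compact sets with `∫ F(g • y) dμ = χ′ g · ∫ F dμ`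
on `S(X)` (`χ′` trivial on `K₀`) and `μ(K₀ • x₀) ≠ 0`; `T` a `χ`-semi-invariant functional (`χ` trivial on `K₀`) with `χ γ ≠ χ′ γ`.  Then
`T(1_{K₀•x₀}) = 0`. [Rallis1984; KudlaRallis1990, §2–3] -/
theorem apply_base_eq_zero_of_char_ne_integral [MeasurableSpace X] [OpensMeasurableSpace X]
    (K₀ : Subgroup G) (hK₀o : IsOpen (K₀ : Set G)) (hK₀c : IsCompact (K₀ : Set G))
    (hopen : ∀ x : X, IsOpenMap fun g : G => g • x) {γ : G} {x₀ : X} (hγ : γ • x₀ = x₀) (χ χ' : G →* ℂ)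
    (hχ : ∀ k ∈ K₀, χ k = 1) (hχ' : ∀ k ∈ K₀, χ' k = 1) (T : (X → ℂ) →ₗ[ℂ] ℂ)
    (hT : ∀ F : X → ℂ, IsLocallyConstant F → HasCompactSupport F → ∀ g : G, T (fun y => F (g • y)) = χ g * T F)
    (μ : Measure X) [IsFiniteMeasureOnCompacts μ]
    (hμ : ∀ (g : G) (F : X → ℂ), IsLocallyConstant F → HasCompactSupport F → ∫ y, F (g • y) ∂μ = χ' g * ∫ y, F y ∂μ)
    (hpos : μ (orbit K₀ x₀) ≠ 0) (hχγ : χ γ ≠ χ' γ) :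
    T ((orbit K₀ x₀).indicator fun _ => (1 : ℂ)) = 0 := by
  have hcont : ∀ x : X, Continuous fun g : G => g • x := fun x => continuous_id.smul continuous_const
  obtain ⟨T', hT'V, hT'⟩ := exists_linear_extension_integral μ χ' hμ
  have hSo : IsOpen (orbit K₀ x₀) := isOpen_orbit_subgroup hopen K₀ hK₀o x₀
  have hSc : IsCompact (orbit K₀ x₀) := isCompact_orbit_subgroup hcont K₀ hK₀c x₀
  have hScl : IsClosed (orbit K₀ x₀) := isClosed_orbit_subgroup hopen K₀ hK₀o x₀
  have hne' : T' ((orbit K₀ x₀).indicator fun _ => (1 : ℂ)) ≠ 0 := by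
    rw [hT'V _ (Literature.GroupTheory.isLocallyConstant_indicator_const_of_isClopen ⟨hScl, hSo⟩ 1)
      (hasCompactSupport_indicator_const_of_isCompact hSc hScl 1), integral_indicator_orbit_eq μ hSo, Ne, Complex.ofReal_eq_zero,
      measureReal_def, ENNReal.toReal_eq_zero_iff, not_or]
    exact ⟨hpos, hSc.measure_lt_top.ne⟩
  exact apply_base_eq_zero_of_char_ne K₀ hK₀o hK₀c hopen hγ χ χ' hχ hχ' T T' hT hT' hne' hχγ

/-- **WRONG-CHARACTER VANISHING ON `S(X)`, MEASURE FORM.** [Rallis1984; KudlaRallis1990, §2–3; KudlaSweet1997, §§2–4] -/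
theorem eq_zero_of_char_ne_integral [MeasurableSpace X] [OpensMeasurableSpace X]
    (K₀ : Subgroup G) (hK₀o : IsOpen (K₀ : Set G)) (hK₀c : IsCompact (K₀ : Set G))
    (hopen : ∀ x : X, IsOpenMap fun g : G => g • x) [IsPretransitive G X] {γ : G} {x₀ : X} (hγ : γ • x₀ = x₀) (χ χ' : G →* ℂ)
    (hχ : ∀ k ∈ K₀, χ k = 1) (hχ' : ∀ k ∈ K₀, χ' k = 1) (T : (X → ℂ) →ₗ[ℂ] ℂ)
    (hT : ∀ F : X → ℂ, IsLocallyConstant F → HasCompactSupport F → ∀ g : G, T (fun y => F (g • y)) = χ g * T F)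
    (μ : Measure X) [IsFiniteMeasureOnCompacts μ]
    (hμ : ∀ (g : G) (F : X → ℂ), IsLocallyConstant F → HasCompactSupport F → ∫ y, F (g • y) ∂μ = χ' g * ∫ y, F y ∂μ)
    (hpos : μ (orbit K₀ x₀) ≠ 0) (hχγ : χ γ ≠ χ' γ) {F : X → ℂ} (hF : IsLocallyConstant F) (hFs : HasCompactSupport F) :
    T F = 0 :=
  eq_zero_of_apply_base_eq_zero K₀ hK₀o hK₀c hopen χ hχ x₀ T hT
    (apply_base_eq_zero_of_char_ne_integral K₀ hK₀o hK₀c hopen hγ χ χ' hχ hχ' T hT μ hμ hpos hχγ) hF hFs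

end Main

end Summit.HodgeConjecture.HodgeConjecture.Cruxes.HLiu418.K2LiuHomogeneousFunctionalVanishing

end
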